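import Literature.AlgebraicGeometry.Resolution.WeightedCentreClassLinearPin
import Literature.AlgebraicGeometry.Resolution.WeightedCentreHeavyTaylor
import HarnessLib

/-!
# THEOREM RZ, toolkit: weights, the projection `killLight`, and direction vectors split by weight class
# (instrument for engine 1's `W(f)` toy model, NOT a resolution theorem)

Small generic facts used to assemble engine 1's THEOREM RZ (cell notes RE-DERIVATION-eng1-g41 §3.7.4; CARVER-NOTES-eng1-g42 T92)
from the cell's instruments — the passage from the first-order identity `D^* ḡ = 0` to ONE weight class `C*`
("`d*` attained exactly on the slots of the lightest class `C*` carrying `P_p`"), and the transfer of pins between `g`,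
`ḡ := g(…, 0_Z, …)` and their `killLight` truncations:

* `isWeightedHomogeneous_weightedHomogeneousComponent`, `isWeightedHomogeneous_killLight`, `of_mem_vars_killLight` — a weighted
  homogeneous component (for another weight) and the truncation `killLight H` of a `w`-homogeneous polynomial are `w`-homogeneous,
  and `killLight H F` involves heavy variables only;
* `weight_eq_of_coeff_pderiv_ne_zero`, `dirDeriv_restrict_eq_zero` — **directions split by weight class**: if `F` is
  `w`-homogeneous and `∂_θ F = 0`, then `∂_{θ|C} F = 0` for the restriction of `θ` to any weight class `C = {j : w_j = u}`
  (the pieces `Σ_{j ∈ C} θ_j ∂_j F` are homogeneous of the distinct weights `μ - u`);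
* `killLight_linSubst` — `killLight H` commutes with a class-linear substitution on a heavy class;
* `eq_single_of_le_of_weight_eq`, `coeff_single_ne_zero_of_pderiv_eq_zero` — **the pin coefficient**: for `F` `w`-homogeneous of
  weight `μ = p·w_i` (positive rational weights) in characteristic `p`, if `X_i` occurs in `F` and `∂_i F = 0` then the
  coefficient of `X_i^p` in `F` is nonzero (exponents of `X_i` are multiples of `p`, and the weight leaves room for `X_i^p` only).

References: Taylor expansion and derivations of polynomial rings [Lang2002, Ch. IV §1, Ch. XIII §4]; the weighted frame
[AbramovichTemkinWlodarczyk2024, §5.1 (p. 1575)].  All statements are OURS (toy-model bookkeeping; AI-written Lean, AI review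
is weaker than expert review) — NOT statements about the invariant of [AbramovichTemkinWlodarczyk2024], NOT progress on the summit.
-/

namespace Literature.AlgebraicGeometry.Resolution.WeightedBlowup

namespace RZToolkit

open MvPolynomial

variable {K : Type*} [Field K] {ι : Type*}

/-! ## Homogeneity and variables of components and truncations -/

/-- A weighted homogeneous component (for a second weight `zw`) of a `w`-homogeneous polynomial is `w`-homogeneous of the same
weight (bookkeeping). [cite: AbramovichTemkinWlodarczyk2024, §5.1 (p. 1575)] -/
theorem isWeightedHomogeneous_weightedHomogeneousComponent {M N : Type*} [AddCommMonoid M] [AddCommMonoid N] {w : ι → M}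
    {zw : ι → N} {G : MvPolynomial ι K} {μ : M} (hG : IsWeightedHomogeneous w G μ) (n : N) :
    IsWeightedHomogeneous w (weightedHomogeneousComponent zw n G) μ := by
  classical
  intro d hd
  rw [coeff_weightedHomogeneousComponent] at hd
  split_ifs at hd with h
  · exact hG hd
  · exact absurd rfl hd

/-- `killLight H` of a `w`-homogeneous polynomial is `w`-homogeneous of the same weight (bookkeeping).
[cite: AbramovichTemkinWlodarczyk2024, §5.1 (p. 1575)] -/
theorem isWeightedHomogeneous_killLight {M : Type*} [AddCommMonoid M] (H : ι → Prop) [DecidablePred H] {w : ι → M}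
    {F : MvPolynomial ι K} {μ : M} (hF : IsWeightedHomogeneous w F μ) : IsWeightedHomogeneous w (killLight H F) μ := by
  intro d hd
  rw [coeff_killLight] at hd
  split_ifs at hd with h
  · exact hF hd
  · exact absurd rfl hd

/-- `killLight H F` involves heavy variables only (bookkeeping). [cite: AbramovichTemkinWlodarczyk2024, §5.1 (p. 1575)] -/
theorem of_mem_vars_killLight (H : ι → Prop) [DecidablePred H] {F : MvPolynomial ι K} {k : ι} (hk : k ∈ (killLight H F).vars) :
    H k := by
  obtain ⟨t, ht, hkt⟩ := (mem_vars_iff_mem_support k).mp hk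
  have h := mem_support_iff.mp ht
  rw [coeff_killLight] at h
  split_ifs at h with hh
  · exact hh k hkt
  · exact absurd rfl h

/-! ## Directions split by weight class -/

/-- A monomial `m` of `∂_j F`, `F` `w`-homogeneous of weight `μ`, weighs `μ - w_j` (bookkeeping). [cite: Lang2002, Ch. IV §1] -/
theorem weight_eq_of_coeff_pderiv_ne_zero {w : ι → ℚ} {F : MvPolynomial ι K} {μ : ℚ} (hF : IsWeightedHomogeneous w F μ)
    {j : ι} {m : ι →₀ ℕ} (hm : coeff m (pderiv j F) ≠ 0) : Finsupp.weight w m = μ - w j := by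
  classical
  rw [coeff_pderiv_eq] at hm
  have h : coeff (m + Finsupp.single j 1) F ≠ 0 := fun h0 => hm (by rw [h0, mul_zero])
  have hw := hF h
  rw [map_add, Finsupp.weight_single, one_smul] at hw
  linarith

/-- **Directions split by weight class** (ours, bookkeeping): if `F` is `w`-homogeneous and `∂_θ F = 0`, then `∂_{θ|C} F = 0` for
the restriction `θ|C` of `θ` to the weight class `C = {j : w_j = u}`. [cite: Lang2002, Ch. IV §1] -/
theorem dirDeriv_restrict_eq_zero [Fintype ι] {w : ι → ℚ} {F : MvPolynomial ι K} {μ : ℚ} (hF : IsWeightedHomogeneous w F μ)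
    {θ : ι → K} (hD : InvariantDirection.dirDeriv θ F = 0) (u : ℚ) :
    InvariantDirection.dirDeriv (fun j => if w j = u then θ j else 0) F = 0 := by
  classical
  ext m
  have hDm := congrArg (coeff m) hD
  rw [InvariantDirection.dirDeriv, coeff_sum, coeff_zero] at hDm ⊢
  simp_rw [coeff_C_mul] at hDm ⊢
  by_cases hm : Finsupp.weight w m = μ - u
  · refine Eq.trans (Finset.sum_congr rfl fun j _ => ?_) hDm
    split_ifs with hj
    · rfl
    · by_cases h0 : coeff m (pderiv j F) = 0
      · rw [h0, mul_zero, mul_zero]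
      · exfalso
        have h := weight_eq_of_coeff_pderiv_ne_zero hF h0
        exact hj (by linarith)
  · refine Finset.sum_eq_zero fun j _ => ?_
    split_ifs with hj
    · by_cases h0 : coeff m (pderiv j F) = 0
      · rw [h0, mul_zero]
      · exact absurd (weight_eq_of_coeff_pderiv_ne_zero hF h0) (by rwa [hj])
    · rw [zero_mul]

/-- The restriction of a direction supported off a class to that class vanishes; the restriction agrees with `θ` on the class
(bookkeeping). [cite: Lang2002, Ch. IV §1] -/
theorem restrict_apply_of_mem [DecidableEq ι] {w : ι → ℚ} {u : ℚ} (θ : ι → K) {S : Finset ι} (hS : ∀ j, j ∈ S ↔ w j = u)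
    (j : ι) : (fun j => if w j = u then θ j else 0) j = if j ∈ S then θ j else 0 := by
  by_cases h : j ∈ S
  · rw [if_pos h]
    exact if_pos ((hS j).mp h)
  · rw [if_neg h]
    exact if_neg fun h' => h ((hS j).mpr h')

/-! ## `killLight` and class-linear substitutions -/

/-- **`killLight H` commutes with a class-linear substitution on a heavy class** (ours, bookkeeping).
[cite: Lang2002, Ch. XIII §4] -/
theorem killLight_linSubst [Fintype ι] [DecidableEq ι] (H : ι → Prop) [DecidablePred H] {S : Finset ι} {A : Matrix ι ι K}
    (hA : InvariantDirection.IsClassLinear S A) (hS : ∀ j ∈ S, H j) (F : MvPolynomial ι K) :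
    killLight H (InvariantDirection.linSubst (fun j k => A j k) F)
      = InvariantDirection.linSubst (fun j k => A j k) (killLight H F) := by
  have key : (killLight (S := K) H).comp (InvariantDirection.linSubst fun j k => A j k)
      = (InvariantDirection.linSubst fun j k => A j k).comp (killLight (S := K) H) := by
    refine MvPolynomial.algHom_ext fun i => ?_
    rw [AlgHom.comp_apply, AlgHom.comp_apply, InvariantDirection.linSubst_X, map_sum, killLight_X, heavyX]
    by_cases hi : H i
    · rw [if_pos hi, InvariantDirection.linSubst_X]
      refine Finset.sum_congr rfl fun k _ => ?_
      rw [map_mul, MvPolynomial.algHom_C, MvPolynomial.algebraMap_eq, killLight_X, heavyX]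
      by_cases hk : H k
      · rw [if_pos hk]
      · have hkS : k ∉ S := fun h => hk (hS k h)
        have hik : i ≠ k := fun h => hk (h ▸ hi)
        rw [if_neg hk, hA i k (Or.inr hkS), Matrix.one_apply_ne hik, C_0]
        simp only [zero_mul, mul_zero]
    · have hiS : i ∉ S := fun h => hi (hS i h)
      rw [if_neg hi, map_zero]
      refine Finset.sum_eq_zero fun k _ => ?_
      rw [map_mul, MvPolynomial.algHom_C, MvPolynomial.algebraMap_eq, hA i k (Or.inl hiS), Matrix.one_apply]
      by_cases hik : i = k
      · subst hik
        rw [if_pos rfl, C_1, one_mul, killLight_X, heavyX, if_neg hi]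
      · rw [if_neg hik, C_0, zero_mul]
  exact AlgHom.congr_fun key F

/-! ## The pin coefficient -/

/-- Weight count (bookkeeping): with positive rational weights, a monomial of weight `μ = p·w_i` whose `X_i`-exponent is `≥ p` is
`X_i^p`. [cite: AbramovichTemkinWlodarczyk2024, §5.1 (p. 1575)] -/
theorem eq_single_of_le_of_weight_eq [DecidableEq ι] {w : ι → ℚ} (hw : ∀ j, 0 < w j) {μ : ℚ} {p : ℕ} {i : ι}
    (hi : (p : ℚ) * w i = μ) {m : ι →₀ ℕ} (hwm : Finsupp.weight w m = μ) (hle : p ≤ m i) : m = Finsupp.single i p := by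
  rw [Finsupp.weight_apply, Finsupp.sum] at hwm
  by_cases hp : p = 0
  · -- weight `0`: `m = 0`
    subst hp
    rw [Finsupp.single_zero]
    have hμ : μ = 0 := by rw [← hi]; simp
    rw [hμ] at hwm
    have hzero := (Finset.sum_eq_zero_iff_of_nonneg fun k _ => nsmul_nonneg (hw k).le _).mp hwm
    ext k
    by_contra hk
    have h := hzero k (Finsupp.mem_support_iff.mpr hk)
    rw [nsmul_eq_mul, mul_eq_zero] at h
    rcases h with h | h
    · exact hk (by exact_mod_cast h)
    · exact (hw k).ne' h
  have hi_mem : i ∈ m.support := Finsupp.mem_support_iff.mpr (by omega)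
  have hsplit := Finset.add_sum_erase m.support (fun k => m k • w k) hi_mem
  rw [hwm] at hsplit
  have hrest_nonneg : 0 ≤ ∑ k ∈ m.support.erase i, m k • w k := Finset.sum_nonneg fun k _ => nsmul_nonneg (hw k).le _
  have hmi_le : (m i : ℚ) * w i ≤ (p : ℚ) * w i := by
    rw [nsmul_eq_mul] at hsplit
    linarith
  have hmi_eq : m i = p := le_antisymm (by exact_mod_cast le_of_mul_le_mul_right hmi_le (hw i)) hle
  have hrest : ∑ k ∈ m.support.erase i, m k • w k = 0 := by
    rw [nsmul_eq_mul, hmi_eq] at hsplit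
    linarith
  have hzero := (Finset.sum_eq_zero_iff_of_nonneg fun k _ => nsmul_nonneg (hw k).le _).mp hrest
  ext k
  by_cases hki : k = i
  · rw [hki, Finsupp.single_eq_same, hmi_eq]
  · rw [Finsupp.single_apply, if_neg (Ne.symm hki)]
    by_contra hk0
    have h := hzero k (Finset.mem_erase.mpr ⟨hki, Finsupp.mem_support_iff.mpr hk0⟩)
    rw [nsmul_eq_mul, mul_eq_zero] at h
    rcases h with h | h
    · exact hk0 (by exact_mod_cast h)
    · exact (hw k).ne' h

/-- **The pin coefficient** (ours, bookkeeping): in characteristic `p`, for `F` `w`-homogeneous of weight `μ = p·w_i` (positive rational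
weights), if `X_i` occurs in `F` and `∂_i F = 0` then `[X_i^p] F ≠ 0`. [cite: Lang2002, Ch. IV §1] -/
theorem coeff_single_ne_zero_of_pderiv_eq_zero [DecidableEq ι] (p : ℕ) [Fact p.Prime] [CharP K p] {w : ι → ℚ}
    (hw : ∀ j, 0 < w j) {μ : ℚ} {F : MvPolynomial ι K} (hF : IsWeightedHomogeneous w F μ) {i : ι} (hi : (p : ℚ) * w i = μ)
    (hvars : i ∈ F.vars) (hD : pderiv i F = 0) : coeff (Finsupp.single i p) F ≠ 0 := by
  obtain ⟨m, hm, him⟩ := (mem_vars_iff_mem_support i).mp hvars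
  have hdvd : p ∣ m i := InvariantDirection.dvd_of_pderiv_eq_zero p hD hm
  have hle : p ≤ m i := Nat.le_of_dvd (Nat.pos_of_ne_zero (Finsupp.mem_support_iff.mp him)) hdvd
  have hmeq : m = Finsupp.single i p := eq_single_of_le_of_weight_eq hw hi (hF (mem_support_iff.mp hm)) hle
  rw [← hmeq]
  exact mem_support_iff.mp hm

/-- The coefficient of the heavy, `zw`-weightless monomial `X_i^p` is the same in `G`, in its `zw`-weight-`0` component and in their
`killLight H` truncations (bookkeeping). [cite: AbramovichTemkinWlodarczyk2024, §5.1 (p. 1575)] -/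
theorem coeff_single_killLight_weightedHomogeneousComponent [DecidableEq ι] {N : Type*} [AddCommMonoid N] (H : ι → Prop)
    [DecidablePred H] {zw : ι → N} {i : ι} (hi : H i) (hzi : zw i = 0) (p : ℕ) (G : MvPolynomial ι K) :
    coeff (Finsupp.single i p) (killLight H (weightedHomogeneousComponent zw 0 G)) = coeff (Finsupp.single i p) G := by
  classical
  have hheavy : IsHeavy H (Finsupp.single i p) := fun k hk => by
    rw [(Finsupp.mem_support_single _ _ _).mp hk |>.1]; exact hi
  rw [coeff_killLight_of_isHeavy H hheavy, coeff_weightedHomogeneousComponent, if_pos]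
  rw [Finsupp.weight_single, hzi, smul_zero]

/-! ## The `Z`-degree of a `Z`-form versus its weight -/

/-- For a monomial in the variables of one weight class `Z` (all of weight `ζ`), the `Z`-degree times `ζ` is the weight (bookkeeping;
"`Z`-degree of the block `P_{p,x}` `= (w_x - pρ₁)/ζ`"). [cite: AbramovichTemkinWlodarczyk2024, §5.1 (p. 1575)] -/
theorem weight_indicator_mul_eq [DecidableEq ι] {Z : Finset ι} {w : ι → ℚ} {ζ : ℚ} (hζ : ∀ i ∈ Z, w i = ζ) {m : ι →₀ ℕ}
    (hm : ∀ i ∈ m.support, i ∈ Z) :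
    ((Finsupp.weight (fun i => if i ∈ Z then (1 : ℕ) else 0) m : ℕ) : ℚ) * ζ = Finsupp.weight w m := by
  rw [Finsupp.weight_apply, Finsupp.weight_apply, Finsupp.sum, Finsupp.sum, Nat.cast_sum, Finset.sum_mul]
  refine Finset.sum_congr rfl fun i hi => ?_
  rw [if_pos (hm i hi), smul_eq_mul, mul_one, nsmul_eq_mul, hζ i (hm i hi)]

/-- Hence two such monomials of the same weight have the same `Z`-degree, and the `Z`-degree is monotone in the weight when `ζ > 0`
(bookkeeping). [cite: AbramovichTemkinWlodarczyk2024, §5.1 (p. 1575)] -/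
theorem weight_indicator_le_iff [DecidableEq ι] {Z : Finset ι} {w : ι → ℚ} {ζ : ℚ} (hζ : ∀ i ∈ Z, w i = ζ) (hζ0 : 0 < ζ)
    {m m' : ι →₀ ℕ} (hm : ∀ i ∈ m.support, i ∈ Z) (hm' : ∀ i ∈ m'.support, i ∈ Z) :
    Finsupp.weight (fun i => if i ∈ Z then (1 : ℕ) else 0) m ≤ Finsupp.weight (fun i => if i ∈ Z then (1 : ℕ) else 0) m' ↔
      Finsupp.weight w m ≤ Finsupp.weight w m' := by
  rw [← weight_indicator_mul_eq hζ hm, ← weight_indicator_mul_eq hζ hm', mul_le_mul_iff_of_pos_right hζ0, Nat.cast_le]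

end RZToolkit

end Literature.AlgebraicGeometry.Resolution.WeightedBlowup
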